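import Summits.ABC.ABC.Theses.IsogenyGlueCongruence
import Summits.ABC.ABC.Theorems.FreyDegreeBound.Negative.LevelAndConductor

/-!
# `DegreePrimesPolyBounded` (stmt-ABC-2045): the role of primality, and the level-one junk edge

Negative support lemmas for the crux `Summit.ABC.ABC.Theses.IsogenyGlueCongruence.DegreePrimesPolyBounded`
(cdisprove seat, cycle 1), complementing `Negative/Pump.lean`:
* `divisors_bounded_iff_degree_bounded` — dropping `ℓ.Prime` from the crux gives EXACTLY the polynomial
  modular-degree conjecture for semistable curves (the consequent of crux B `PolyDegreeOfBoundedPrimes`):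
  primality is the whole gap between crux A and Frey's conjecture;
* `isEmpty_modularParametrizationData_of_eq_one` — no parametrisation datum exists at level `1`
  (`S₂(SL₂(ℤ)) = 0` in Mathlib; reused from `FreyDegreeBound/Negative/LevelAndConductor.lean`), whence `not_degreePrimesPolyBounded_of_conductorNorm_eq_one`: the crux is
  junk-false iff the tree's `conductorNorm ℤ` takes the value `1` on a semistable globally-minimal elliptic curve
  (mathematically excluded — no `E/ℚ` has everywhere good reduction — but that fact is not in the tree).
-/

noncomputable section

namespace Summit.ABC.ABC.Theorems.DegreePrimesPolyBounded.Negative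

open scoped MatrixGroups
open Literature.NumberTheory.EllipticCurves.ModularForms CongruenceSubgroup UpperHalfPlane
open Summit.ABC.ABC.Theses.IsogenyGlueCongruence

/-- **Primality is the whole gap.** "Every DIVISOR of the degree of some datum is `≤ C N^κ`" is equivalent to
"the degree of some datum is `≤ C N^κ`" (take `ℓ = deg`; conversely divisors of a positive number are at most
the number): the crux without `ℓ.Prime` is the polynomial modular-degree conjecture itself. [folklore] -/
theorem divisors_bounded_iff_degree_bounded :
    (∃ κ C : ℝ, ∀ (W : WeierstrassCurve ℚ) [W.IsElliptic] [W.IsGloballyMinimal] [NeZero (W.conductorNorm ℤ)],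
        W.IsSemistable ℤ → ∃ D : ModularParametrizationData W (W.conductorNorm ℤ),
          ∀ ℓ : ℕ, ℓ ∣ D.modularDegree → (ℓ : ℝ) ≤ C * (W.conductorNorm ℤ : ℝ) ^ κ) ↔
    (∃ κ C : ℝ, ∀ (W : WeierstrassCurve ℚ) [W.IsElliptic] [W.IsGloballyMinimal] [NeZero (W.conductorNorm ℤ)],
        W.IsSemistable ℤ → ∃ D : ModularParametrizationData W (W.conductorNorm ℤ),
          (D.modularDegree : ℝ) ≤ C * (W.conductorNorm ℤ : ℝ) ^ κ) := by
  constructor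
  · rintro ⟨κ, C, h⟩
    refine ⟨κ, C, fun W _ _ _ hW ↦ ?_⟩
    obtain ⟨D, hD⟩ := h W hW
    exact ⟨D, hD _ dvd_rfl⟩
  · rintro ⟨κ, C, h⟩
    refine ⟨κ, C, fun W _ _ _ hW ↦ ?_⟩
    obtain ⟨D, hD⟩ := h W hW
    refine ⟨D, fun ℓ hdvd ↦ le_trans ?_ hD⟩
    exact_mod_cast Nat.le_of_dvd D.deg_pos hdvd

/-- The crux follows from the polynomial modular-degree conjecture restricted to prime divisors — i.e. crux A
is implied by the consequent of crux B; recorded contrapositively: a refutation of A refutes Frey's polynomial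
degree conjecture for semistable curves. [folklore] -/
theorem not_degree_bounded_of_not_degreePrimesPolyBounded (h : ¬ DegreePrimesPolyBounded) :
    ¬ ∃ κ C : ℝ, ∀ (W : WeierstrassCurve ℚ) [W.IsElliptic] [W.IsGloballyMinimal] [NeZero (W.conductorNorm ℤ)],
        W.IsSemistable ℤ → ∃ D : ModularParametrizationData W (W.conductorNorm ℤ),
          (D.modularDegree : ℝ) ≤ C * (W.conductorNorm ℤ : ℝ) ^ κ := by
  rintro ⟨κ, C, hC⟩
  refine h ⟨κ, C, fun W _ _ _ hW ↦ ?_⟩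
  obtain ⟨D, hD⟩ := hC W hW
  refine ⟨D, fun ℓ _ hdvd ↦ le_trans ?_ hD⟩
  exact_mod_cast Nat.le_of_dvd D.deg_pos hdvd

/-- … and a refutation of A refutes the route's target X (`SemistableDegreeConjecture`, `ε := 1`).
[folklore] -/
theorem not_semistableDegreeConjecture_of_not_degreePrimesPolyBounded (h : ¬ DegreePrimesPolyBounded) :
    ¬ SemistableDegreeConjecture := by
  intro hX
  obtain ⟨C, hC⟩ := hX 1 one_pos
  refine not_degree_bounded_of_not_degreePrimesPolyBounded h ⟨2 + 1, C, fun W _ _ _ hW ↦ ?_⟩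
  obtain ⟨D, hD⟩ := hC W hW
  exact ⟨D, hD⟩

/-- No modular parametrisation datum at level `M = 1` (transport of the sibling crux's
`FreyDegreeBound.Negative.isEmpty_modularParametrizationData_one`: the newform would be a normalised element of
`S₂(Γ₀(1)) = 0`), in the form needed to rewrite along `conductorNorm = 1` inside the dependent type. [folklore] -/
theorem isEmpty_modularParametrizationData_of_eq_one (W : WeierstrassCurve ℚ) (M : ℕ) [NeZero M]
    (hM : M = 1) : IsEmpty (ModularParametrizationData W M) := by
  subst hM
  exact Summit.ABC.ABC.Theorems.FreyDegreeBound.Negative.isEmpty_modularParametrizationData_one W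

/-- **The only junk model.** If the tree's `conductorNorm ℤ` evaluated to `1` on some semistable globally-minimal
elliptic curve, the crux would be (junk-)false: no datum exists at level `1`. (Mathematically `N_E ≥ 11`:
no `E/ℚ` has everywhere good reduction, and for semistable `W` the conductor is `rad(Δ_min)`; that fact is not
in the tree, so this edge can neither be used by a refuter nor met by a prover working from modularity facts.)
[folklore] -/
theorem not_degreePrimesPolyBounded_of_conductorNorm_eq_one (W : WeierstrassCurve ℚ) [W.IsElliptic]
    [W.IsGloballyMinimal] [NeZero (W.conductorNorm ℤ)] (hW : W.IsSemistable ℤ) (hN : W.conductorNorm ℤ = 1) :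
    ¬ DegreePrimesPolyBounded := by
  rintro ⟨κ, C, h⟩
  obtain ⟨D, -⟩ := h W hW
  exact (isEmpty_modularParametrizationData_of_eq_one W _ hN).false D

end Summit.ABC.ABC.Theorems.DegreePrimesPolyBounded.Negative
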